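import Summits.BirchSwinnertonDyer.Rank1Residual.Additive.X4ExoticThree
import Summits.BirchSwinnertonDyer.Rank1Residual.Additive.X4ExoticValuationThree
import Summits.BirchSwinnertonDyer.Rank1Residual.Additive.X4ExoticWildTorsion
import Summits.BirchSwinnertonDyer.Rank1Residual.Additive.X4ExoticNotCubeRoot
import Summits.BirchSwinnertonDyer.Rank1Residual.Additive.X4ExoticWild
import Summits.BirchSwinnertonDyer.Rank1Residual.GaloisImage.ExoticThreeAdicImage
import Summits.BirchSwinnertonDyer.Rank1Residual.GaloisImage.ExoticNoHigherLevelTau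
import Literature.NumberTheory.EllipticCurves.Kato2004.Condition1252
import HarnessLib

/-!
# The EXOTIC CORE of X4 at `3` — every kernel restriction on a surj(3), tower-less X4 row, CONJOINED
# (cell `b2b-bsdres`, team n1011, seat p14 gen 4; the 'EXOTIC-restriction assembly' of lead ruling
# R5-81 (n); index theorem over the T-b9 / T-b10 / T-b11 lineages of n1011-p02, n1011-p14, cc-typer-1)

HONEST FRAMING (cell `b2b-bsdres`, run/shared/lean/b2b/bsd-rank1-residual/, verbatim in every
file): the goal of the cell is to DELETE the COMBINATION-SHAPED residual classes of the
Birch–Swinnerton-Dyer formula for ALL analytic-rank `≤ 1` elliptic curves over `ℚ` — "full BSD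
formula for every rank `≤ 1` curve in class `C`" assembled STRICTLY from published theorems — so
that the rank-`≤ 1` remainder becomes exactly the CONSTRUCTION-SHAPED classes, which are TYPED
(missing-input `Prop`s), NOT attempted. This is not "finishing BSD". Team n1011 (N10 / N11, the
additive block X4 ∧ `p = 3`): research route; no claim beyond the stated classes; the label X4 is
UNCHANGED by this file; nothing is booked. Theorems only (no definition, no named fact minted; every
published input of the end-state is an explicit named-fact hypothesis, as in p250513 / p251574).

## What this file proves

An EXOTIC row of X4 at `3` is a globally minimal `E/ℚ`, additive at `3` with `ρ̄_{E,3}` irreducible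
(`ClassX4 W 3`), `ρ̄_{E,3}` ONTO `GL₂(𝔽₃)` (`Surj W 3`), whose `3`-adic tower `∀ n, ρ̄_{E,3ⁿ} onto`
FAILS.  The tree proves, in separate files, a dozen necessary conditions; this file states them as
ONE conjunction and carries that conjunction into the X4 end-state.

* §1 **`ClassX4.exotic_core_of_not_towerSurj_three`** — EXOTIC ⟹
  (I) IMAGE: `ρ̄_{E,9}` not onto (Serre's lifting lemma, `forall_hasSurjectiveModNGaloisRep_three_pow_of_nine`),
  ¬(im) (`¬ BigIm W 3`: no `σ ∈ G_{ℚ(μ_{3^∞})}` with `T₃E/(σ−1)` free of rank one — cc-typer-1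
  `not_bigIm_of_surj_three_of_not_towerSurj`), Kato's (12.5.2) fails at `3`, and NO Sakamoto /
  Mazur–Rubin `τ` at any level `3^{k+1}`, `k ≥ 1` (`not_exists_tau_level_spelling_of_exotic_of_le`);
  (II) LOCAL TYPE AT `3`: the wild cell (w) (`SubW W 3`: not potentially multiplicative, `f₃ ≠ 2`)
  and Kodaira symbol `II`, `IV`, `IV*` or `II*` (`ClassX4.kodairaSymbolAt_wild_of_not_towerSurj_three`);
  (III) `j`-ADIC SIGNATURE: `v₃(j − 1728) = 3` exactly, `v₃(j) ≥ 3`, the Hauptmodul SIGNATURE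
  (`v₃ j = V`, `9 ∣ num(j/3^V − c)`, `(V, c mod 9)` of signature type) and ARM B (`9 ∣ ord_q j` at every
  prime `q ≠ 3` with `ord_q j < 0`) — n1011-p02 `ClassX4.exotic_signature_sharp_of_not_towerSurj_three`,
  `ClassX4.three_le_padicValRat_j_of_not_towerSurj_three` (the `v₃(j − 1728) = 3` step is of record
  also as n1011-p14's `ClassX4.padicValRat_j_sub_eq_three_of_not_towerSurj_three`, `X4ExoticThree`);
  (IV) WILD `3`-TORSION AT `3`: `3 ∣ #ρ̄_{E,3}(I_𝔓)` for every place datum at `3`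
  (`ClassX4.wildTorsion_of_not_towerSurj_three`);
  (V) NOT A CUBE-ROOT ROW and NOT A `c₆`-RESIDUE ROW (`ClassX4.not_cubeRootRow_of_not_towerSurj_three`,
  `ClassX4.not_c₆Residue_of_not_towerSurj_three`, class side of n1011-p02's F3c/F3d).
* §2 `exotic_iff_exotic_of_core` and the END-STATE
  **`x4SharpUnitFree_iff_lower_and_residues_sharp_exoticCore_noL20`** — p251574's eight-fact X4
  end-state (`…_exoticTypeG_noL20`) with the EXOTIC piece quantified ONLY over the rows carrying the
  whole core (I)–(V), and with NO separate "tower fails" hypothesis (conjunct (I) already breaks the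
  tower at `n = 2`).  It refines, conjunct by conjunct, the end-states `…_exoticThree_noL20`
  (p268581), `…_exoticSig_noL20` (p303047), `…_exoticWildTorsion_noL20` (p305525),
  `…_exoticNotCubeRoot_noL20` / `…_exoticNotC6Residue_noL20` (p277591 / p280736).  The Elkies form of
  the EXOTIC piece (`j ∈ f(ℙ¹(ℚ))` modulo the one cited moduli sentence [Elkies2006]) is n1011-p10's
  row T-b11-ELK (`GaloisImage/ElkiesModNineImageOfNoTower`, `Additive/X4ExoticIsElkies`) and is NOT
  restated here; the class-free dichotomy and the junction "core ⟺ `j ∈ f(ℙ¹(ℚ))` (mod `hmod`)" are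
  the sequel `Additive/X4ExoticCoreClassFree.lean`.

Census reading (EVIDENCE, unchanged by this file; `HOME/b2b-bsdres-n1011-p14/e11/EXO3-LOCAL-WITNESS.md`,
`HOME/b2b-bsdres-n1011-p02/f4g6/M3-KERNEL-INDEX.tsv`, rmap-2 TOWER CONCORDANCE): of the 341 `r_an = 0`
EXOTIC-candidate cells of the X4-at-3 census (`N < 5·10⁵`), 321 carry a kernel tower theorem or
instance and the 20 Elkies cells (three `j`-invariants `15786448344`, `−44789760`, `4374`) carry a
kernel NO-tower theorem modulo [Elkies2006]; all 20 have `v₃(N) = 5`, `v₃(j) ∈ {7, 8}`,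
`v₃(j − 1728) = 3`.  Nothing booked; X4 CONSTRUCTION-SHAPED; no label change.

References: [SerreAbelianLadic1968] IV §3.4 Lemma 3 (IV-23); [Wuthrich2014] Lemma 20 (p. 399);
[Kato2004Asterisque] (12.5.2), Thm. 13.4 (3), Thm. 14.5 (3); [BurungaleCastellaSkinner2025] (im);
[Sakamoto2024] §2 (H.2); [SerreLocalFields1979] I §7; [Serre1972] §5.3; [Maier2006] Table 4;
[Elkies2006] §1; [SilvermanATAEC1994] IV.9.4, Table 4.1; [Zywina2015] Prop. 1.14.
-/

noncomputable section

open scoped Classical NumberField Pointwise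

open Field IsDedekindDomain IsDedekindDomain.HeightOneSpectrum NumberField WeierstrassCurve
  Rat.HeightOneSpectrum
  Literature.NumberTheory.EllipticCurves
  Literature.NumberTheory.EllipticCurves.ModularForms
  Literature.NumberTheory.EllipticCurves.Rank1Residual
  Literature.NumberTheory.EllipticCurves.Rank1Residual.Typed
  Literature.NumberTheory.GaloisRepresentations Literature.NumberTheory.GaloisCohomology
  Summit.BirchSwinnertonDyer.Rank1Residual.GaloisImage

namespace Summit.BirchSwinnertonDyer.Rank1Residual.Additive

/-! ### §1 The EXOTIC core: every kernel restriction, conjoined -/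

section Core

variable {W : WeierstrassCurve ℚ} [W.IsElliptic] [W.IsGloballyMinimal]

/-- **THE EXOTIC CORE OF X4 AT `3`.**  An X4 pair at `3` with `ρ̄_{E,3}` onto whose `3`-adic tower
FAILS satisfies, all at once: (I) `ρ̄_{E,9}` not onto, ¬(im) at `3`, Kato's (12.5.2) fails at `3`,
and no level-`3^{k+1}` Kolyvagin `τ` for any `k ≥ 1`; (II) the wild cell (w) and Kodaira symbol
`II/IV/IV*/II*` at `3`; (III) `v₃(j − 1728) = 3`, `v₃ j ≥ 3`, the Hauptmodul SIGNATURE and ARM B;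
(IV) wild `3`-torsion at `3` for every place datum; (V) no cube-root digit row and no `c₆`-residue
digit row.  Index theorem: each conjunct is a tree theorem of the n1011 T-b9/T-b10/T-b11 lineages
(module docstring). [cite: SerreAbelianLadic1968, Ch. IV §3.4, Lemma 3 (IV-23)]
[cite: Wuthrich2014, Lemma 20 (p. 399)] [cite: Kato2004Asterisque, (12.5.2) in Thm. 12.5 (4) (p. 222)]
[cite: BurungaleCastellaSkinner2025, p. 2, hypothesis (im)] [cite: Sakamoto2024, §2 hypothesis (H.2) (p. 921)]
[cite: SilvermanATAEC1994, IV.9.4 and Table 4.1 (PDF p. 365)] [cite: Maier2006, Table 4 (N = 3, 9) and §5]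
[cite: Elkies2006, §1] [cite: SerreLocalFields1979, Ch. I §7 Cor. to Prop. 21 and Prop. 22(b)]
[cite: Serre1972, §5.3] -/
theorem ClassX4.exotic_core_of_not_towerSurj_three [Fact (Nat.Prime 3)]
    (hX : ClassX4 W 3) (hsurj : Surj W 3) (hnot : ¬ ∀ n : ℕ, W.HasSurjectiveModNGaloisRep (3 ^ n : ℕ)) :
    -- (I) image side
    (¬ W.HasSurjectiveModNGaloisRep 9 ∧ ¬ BigIm W 3 ∧ ¬ Kato2004.ImageContainsSL2 W 3 ∧
      ∀ k : ℕ, 1 ≤ k →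
        ¬ ∃ τ : Field.absoluteGaloisGroup ℚ, τ ∈ rootsOfUnityFixer ℚ (3 ^ (k + 1)) ∧
          Nonempty (cokerSubOne (W.torsionGaloisModule (((3 : ℕ) : ℤ) ^ k * ((3 : ℕ) : ℤ))) τ ≃+
            ZMod (3 ^ (k + 1)))) ∧
    -- (II) local type at `3`
    (SubW W 3 ∧
      (W.kodairaSymbolAt (placeOf 3) = .II ∨ W.kodairaSymbolAt (placeOf 3) = .IV ∨
        W.kodairaSymbolAt (placeOf 3) = .IVstar ∨ W.kodairaSymbolAt (placeOf 3) = .IIstar)) ∧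
    -- (III) `j`-adic signature
    (padicValRat 3 (W.j - 1728) = 3 ∧ 3 ≤ padicValRat 3 W.j ∧
      (∃ (V : ℕ) (c : ℤ), padicValRat 3 W.j = V ∧ (9 : ℤ) ∣ (W.j / 3 ^ V - c).num ∧
        ((V = 3 ∧ c % 9 = 8) ∨
         (6 ≤ V ∧ V % 3 = 0 ∧ (c % 9 = 1 ∨ c % 9 = 8)) ∨
         (V = 7 ∧ (c % 9 = 2 ∨ c % 9 = 4)) ∨
         (8 ≤ V ∧ V % 3 ≠ 0 ∧ (c % 9 = 1 ∨ c % 9 = 8)))) ∧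
      ∀ q : ℕ, q.Prime → q ≠ 3 → padicValRat q W.j < 0 → (9 : ℤ) ∣ padicValRat q W.j) ∧
    -- (IV) wild `3`-torsion at `3`
    (∀ (v : HeightOneSpectrum (𝓞 ℚ)), (primesEquiv v : ℕ) = 3 →
      ∀ (𝔓 : Ideal (absIntegers (𝓞 ℚ) ℚ)),
        (∀ x : absIntegers (𝓞 ℚ) ℚ, x ∈ 𝔓 ↔ (x : AlgebraicClosure ℚ) ∈ (placeOver 3).nonunits) →
        𝔓 ∈ v.primesAbove →
        3 ∣ Nat.card ((𝔓.inertia (absoluteGaloisGroup ℚ)).map (galoisRepTorsion W 3))) ∧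
    -- (V) no cube-root digit row, no `c₆`-residue digit row
    ((∀ (n₄ n₆ nΔ : ℕ), padicValRat 3 W.c₄ = n₄ → padicValRat 3 W.c₆ = n₆ →
        padicValRat 3 W.Δ = nΔ → 2 * n₆ = nΔ + 3 → nΔ + 6 ≤ 3 * n₄ → 3 ∣ n₆ →
        ∀ c : ℚ, ¬ (c ^ 3 * W.Δ / (2 * W.c₆) - 1 = 0 ∨
          (2 : ℤ) ≤ padicValRat 3 (c ^ 3 * W.Δ / (2 * W.c₆) - 1))) ∧
      (∀ (n₄ n₆ nΔ : ℕ), padicValRat 3 W.c₄ = n₄ → padicValRat 3 W.c₆ = n₆ →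
        padicValRat 3 W.Δ = nΔ → 2 * n₆ = nΔ + 3 → nΔ + 6 ≤ 3 * n₄ → 3 ∣ n₆ →
        ∀ s : ℤ, s = 1 ∨ s = -1 →
          ¬ (W.c₆ / 3 ^ n₆ - 2 * s = 0 ∨ (2 : ℤ) ≤ padicValRat 3 (W.c₆ / 3 ^ n₆ - 2 * s)))) := by
  have h9 : ¬ W.HasSurjectiveModNGaloisRep 9 := fun h ↦
    hnot (WeierstrassCurve.forall_hasSurjectiveModNGaloisRep_three_pow_of_nine W h)
  have h1728 := ClassX4.padicValRat_j_sub_eq_three_of_not_towerSurj_three hX hsurj hnot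
  obtain ⟨hS, -, hsig, harmB⟩ := ClassX4.exotic_signature_sharp_of_not_towerSurj_three hX hsurj hnot
  refine ⟨⟨h9, not_bigIm_of_surj_three_of_not_towerSurj W hsurj hnot,
      not_imageContainsSL2_three_of_not_towerSurj W hnot,
      fun k hk ↦ not_exists_tau_level_spelling_of_exotic_of_le W hsurj h9 hk⟩,
    ⟨hS, ClassX4.kodairaSymbolAt_wild_of_not_towerSurj_three hX hsurj hnot⟩,
    ⟨h1728, ClassX4.three_le_padicValRat_j_of_not_towerSurj_three hX hsurj hnot, hsig, harmB⟩,
    fun v hv 𝔓 hmem h𝔓 ↦ ClassX4.wildTorsion_of_not_towerSurj_three hX hsurj hnot hv hmem h𝔓,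
    ⟨fun n₄ n₆ nΔ h₄ h₆ hΔ hm hj h3 c ↦
        ClassX4.not_cubeRootRow_of_not_towerSurj_three hX hsurj hnot h₄ h₆ hΔ hm hj h3 c,
      fun n₄ n₆ nΔ h₄ h₆ hΔ hm hj h3 s hs ↦
        ClassX4.not_c₆Residue_of_not_towerSurj_three hX hsurj hnot h₄ h₆ hΔ hm hj h3 hs⟩⟩

end Core

/-! ### §2 The X4 end-state with the EXOTIC piece on the CORE rows only -/

/-- **The EXOTIC hypothesis RESTRICTED to the core rows, with NO separate tower hypothesis.**
p251574's EXOTIC piece (`p = 3`, `r_an = 0`, X4, surj(3), `ord₃ j ≥ 0`, `¬ TypeG W 3`, tower fails ⟹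
upper half) is EQUIVALENT to: every `r_an = 0` X4 pair at `3` with surj(3) carrying the whole core
(I)–(V) has the upper half.  (⟸: §1; ⟹: conjunct (I) `ρ̄_{E,9}` not onto already breaks the tower at
`n = 2`, and `ord₃ j ≥ 0`, `¬ TypeG` follow from the failing tower,
`ClassX4.not_potMult_and_not_typeG_of_not_towerSurj_three`.) [cite: Wuthrich2014, Lemma 20 (p. 399)]
[cite: SerreAbelianLadic1968, Ch. IV §3.4, Lemma 3 (IV-23)] -/
theorem exotic_iff_exotic_of_core :
    (∀ (W : WeierstrassCurve ℚ) [W.IsElliptic] [W.IsGloballyMinimal],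
        W.analyticRank = 0 → ClassX4 W 3 → Surj W 3 → 0 ≤ padicValRat 3 W.j → ¬ TypeG W 3 →
        ¬ (∀ n : ℕ, W.HasSurjectiveModNGaloisRep (3 ^ n : ℕ)) → MissingUpperBoundAt W 3) ↔
    (∀ (W : WeierstrassCurve ℚ) [W.IsElliptic] [W.IsGloballyMinimal],
        W.analyticRank = 0 → ClassX4 W 3 → Surj W 3 →
        -- (I) image side
        (¬ W.HasSurjectiveModNGaloisRep 9 ∧ ¬ BigIm W 3 ∧ ¬ Kato2004.ImageContainsSL2 W 3 ∧
          ∀ k : ℕ, 1 ≤ k →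
            ¬ ∃ τ : Field.absoluteGaloisGroup ℚ, τ ∈ rootsOfUnityFixer ℚ (3 ^ (k + 1)) ∧
              Nonempty (cokerSubOne (W.torsionGaloisModule (((3 : ℕ) : ℤ) ^ k * ((3 : ℕ) : ℤ))) τ ≃+
                ZMod (3 ^ (k + 1)))) ∧
        -- (II) local type at `3`
        (SubW W 3 ∧
          (W.kodairaSymbolAt (placeOf 3) = .II ∨ W.kodairaSymbolAt (placeOf 3) = .IV ∨
            W.kodairaSymbolAt (placeOf 3) = .IVstar ∨ W.kodairaSymbolAt (placeOf 3) = .IIstar)) ∧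
        -- (III) `j`-adic signature
        (padicValRat 3 (W.j - 1728) = 3 ∧ 3 ≤ padicValRat 3 W.j ∧
          (∃ (V : ℕ) (c : ℤ), padicValRat 3 W.j = V ∧ (9 : ℤ) ∣ (W.j / 3 ^ V - c).num ∧
            ((V = 3 ∧ c % 9 = 8) ∨
             (6 ≤ V ∧ V % 3 = 0 ∧ (c % 9 = 1 ∨ c % 9 = 8)) ∨
             (V = 7 ∧ (c % 9 = 2 ∨ c % 9 = 4)) ∨
             (8 ≤ V ∧ V % 3 ≠ 0 ∧ (c % 9 = 1 ∨ c % 9 = 8)))) ∧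
          ∀ q : ℕ, q.Prime → q ≠ 3 → padicValRat q W.j < 0 → (9 : ℤ) ∣ padicValRat q W.j) ∧
        -- (IV) wild `3`-torsion at `3`
        (∀ (v : HeightOneSpectrum (𝓞 ℚ)), (primesEquiv v : ℕ) = 3 →
          ∀ (𝔓 : Ideal (absIntegers (𝓞 ℚ) ℚ)),
            (∀ x : absIntegers (𝓞 ℚ) ℚ, x ∈ 𝔓 ↔ (x : AlgebraicClosure ℚ) ∈ (placeOver 3).nonunits) →
            𝔓 ∈ v.primesAbove →
            3 ∣ Nat.card ((𝔓.inertia (absoluteGaloisGroup ℚ)).map (galoisRepTorsion W 3))) ∧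
        -- (V) no cube-root digit row, no `c₆`-residue digit row
        ((∀ (n₄ n₆ nΔ : ℕ), padicValRat 3 W.c₄ = n₄ → padicValRat 3 W.c₆ = n₆ →
            padicValRat 3 W.Δ = nΔ → 2 * n₆ = nΔ + 3 → nΔ + 6 ≤ 3 * n₄ → 3 ∣ n₆ →
            ∀ c : ℚ, ¬ (c ^ 3 * W.Δ / (2 * W.c₆) - 1 = 0 ∨
              (2 : ℤ) ≤ padicValRat 3 (c ^ 3 * W.Δ / (2 * W.c₆) - 1))) ∧
          (∀ (n₄ n₆ nΔ : ℕ), padicValRat 3 W.c₄ = n₄ → padicValRat 3 W.c₆ = n₆ →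
            padicValRat 3 W.Δ = nΔ → 2 * n₆ = nΔ + 3 → nΔ + 6 ≤ 3 * n₄ → 3 ∣ n₆ →
            ∀ s : ℤ, s = 1 ∨ s = -1 →
              ¬ (W.c₆ / 3 ^ n₆ - 2 * s = 0 ∨ (2 : ℤ) ≤ padicValRat 3 (W.c₆ / 3 ^ n₆ - 2 * s)))) →
        MissingUpperBoundAt W 3) := by
  haveI : Fact (Nat.Prime 3) := ⟨Nat.prime_three⟩
  constructor
  · intro h V _ _ hr hX hs hcore
    have hnot : ¬ ∀ n : ℕ, V.HasSurjectiveModNGaloisRep (3 ^ n : ℕ) := fun ht ↦ by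
      have h2 := ht 2
      rw [show ((3 ^ 2 : ℕ) : ℤ) = 9 by norm_num] at h2
      exact hcore.1.1 h2
    exact h V hr hX hs (le_trans (by norm_num) hcore.2.2.1.2.1)
      (ClassX4.not_potMult_and_not_typeG_of_not_towerSurj_three hX hs hnot).2 hnot
  · intro h V _ _ hr hX hs _ _ hnot
    exact h V hr hX hs (ClassX4.exotic_core_of_not_towerSurj_three hX hs hnot)

/-- **THE END-STATE OF CLASS X4 ON EIGHT NAMED FACTS with the EXOTIC piece on the CORE rows ONLY:
X4♯(unit-free) ⟺ LOWER ∧ EXOTIC(core (I)–(V)) ∧ TAM-DEFECT₂♭ ∧ ODD-SHA♭ ∧ MANIN♭** — p251574's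
`x4SharpUnitFree_iff_lower_and_residues_sharp_exoticTypeG_noL20` rewritten along
`exotic_iff_exotic_of_core`; it refines conjunct by conjunct the end-states `…_exoticThree_noL20`,
`…_exoticSig_noL20`, `…_exoticWildTorsion_noL20`, `…_exoticNotCubeRoot_noL20`, `…_exoticNotC6Residue_noL20`.
No named fact beyond the eight; X4 stays CONSTRUCTION-SHAPED; nothing booked.
[cite: Kato2004Asterisque, Thm. 14.5 (3) (p. 236), Thm. 17.4 (3) (p. 273)] [cite: Delbourgo1998, Prop. 4 (p. 144)]
[cite: Wuthrich2014, Lemma 20 (p. 399)] [cite: SilvermanAEC2009, Thm. X.4.14]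
[cite: Kim2022StructureSelmer, Conj. 1.10 (PDF p. 8)] [cite: Miller2011LMS, Def. 1.1]
[cite: Sakamoto2024, §2 hypothesis (H.2) (p. 921)] [cite: Maier2006, Table 4 (N = 3, 9) and §5]
[cite: SerreLocalFields1979, Ch. I §7 Cor. to Prop. 21 and Prop. 22(b)] [cite: Serre1972, §5.3] -/
theorem x4SharpUnitFree_iff_lower_and_residues_sharp_exoticCore_noL20
    (hCT : exists_casselsTate_pairing (K := ℚ))
    (hKatoS : Kato2004.rankZero_padicValNat_sha_le_sub_localTamagawa_of_additive_potGood_of_imageContainsSL2)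
    (hDel : Delbourgo1998.prop4_rankZero_pow_dvd_constantCoeff)
    (hGZK : rank_eq_analyticRank_of_analyticRank_le_one) (hmod : hasEntireLFunction_rat)
    (hmodD : nonempty_modularParametrizationData)
    (hKatoχ : Wuthrich2014.kato_halfEigenCharIdeal_dvd_cyclotomicPrime_of_surjective)
    (hK : Kato2004.charIdeal_dvd_padicLFunctionBranch_component_of_surjective) :
    X4SharpUnitFree ↔
      (∀ (W : WeierstrassCurve ℚ) [W.IsElliptic] [W.IsGloballyMinimal] (p : ℕ) [Fact p.Prime],
          W.analyticRank = 0 → ClassX4 W p → Surj W p → MissingLowerBoundAt W p) ∧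
      (∀ (W : WeierstrassCurve ℚ) [W.IsElliptic] [W.IsGloballyMinimal],
          W.analyticRank = 0 → ClassX4 W 3 → Surj W 3 →
          -- (I) image side
          (¬ W.HasSurjectiveModNGaloisRep 9 ∧ ¬ BigIm W 3 ∧ ¬ Kato2004.ImageContainsSL2 W 3 ∧
            ∀ k : ℕ, 1 ≤ k →
              ¬ ∃ τ : Field.absoluteGaloisGroup ℚ, τ ∈ rootsOfUnityFixer ℚ (3 ^ (k + 1)) ∧
                Nonempty (cokerSubOne (W.torsionGaloisModule (((3 : ℕ) : ℤ) ^ k * ((3 : ℕ) : ℤ))) τ ≃+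
                  ZMod (3 ^ (k + 1)))) ∧
          -- (II) local type at `3`
          (SubW W 3 ∧
            (W.kodairaSymbolAt (placeOf 3) = .II ∨ W.kodairaSymbolAt (placeOf 3) = .IV ∨
              W.kodairaSymbolAt (placeOf 3) = .IVstar ∨ W.kodairaSymbolAt (placeOf 3) = .IIstar)) ∧
          -- (III) `j`-adic signature
          (padicValRat 3 (W.j - 1728) = 3 ∧ 3 ≤ padicValRat 3 W.j ∧
            (∃ (V : ℕ) (c : ℤ), padicValRat 3 W.j = V ∧ (9 : ℤ) ∣ (W.j / 3 ^ V - c).num ∧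
              ((V = 3 ∧ c % 9 = 8) ∨
               (6 ≤ V ∧ V % 3 = 0 ∧ (c % 9 = 1 ∨ c % 9 = 8)) ∨
               (V = 7 ∧ (c % 9 = 2 ∨ c % 9 = 4)) ∨
               (8 ≤ V ∧ V % 3 ≠ 0 ∧ (c % 9 = 1 ∨ c % 9 = 8)))) ∧
            ∀ q : ℕ, q.Prime → q ≠ 3 → padicValRat q W.j < 0 → (9 : ℤ) ∣ padicValRat q W.j) ∧
          -- (IV) wild `3`-torsion at `3`
          (∀ (v : HeightOneSpectrum (𝓞 ℚ)), (primesEquiv v : ℕ) = 3 →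
            ∀ (𝔓 : Ideal (absIntegers (𝓞 ℚ) ℚ)),
              (∀ x : absIntegers (𝓞 ℚ) ℚ, x ∈ 𝔓 ↔ (x : AlgebraicClosure ℚ) ∈ (placeOver 3).nonunits) →
              𝔓 ∈ v.primesAbove →
              3 ∣ Nat.card ((𝔓.inertia (absoluteGaloisGroup ℚ)).map (galoisRepTorsion W 3))) ∧
          -- (V) no cube-root digit row, no `c₆`-residue digit row
          ((∀ (n₄ n₆ nΔ : ℕ), padicValRat 3 W.c₄ = n₄ → padicValRat 3 W.c₆ = n₆ →
              padicValRat 3 W.Δ = nΔ → 2 * n₆ = nΔ + 3 → nΔ + 6 ≤ 3 * n₄ → 3 ∣ n₆ →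
              ∀ c : ℚ, ¬ (c ^ 3 * W.Δ / (2 * W.c₆) - 1 = 0 ∨
                (2 : ℤ) ≤ padicValRat 3 (c ^ 3 * W.Δ / (2 * W.c₆) - 1))) ∧
            (∀ (n₄ n₆ nΔ : ℕ), padicValRat 3 W.c₄ = n₄ → padicValRat 3 W.c₆ = n₆ →
              padicValRat 3 W.Δ = nΔ → 2 * n₆ = nΔ + 3 → nΔ + 6 ≤ 3 * n₄ → 3 ∣ n₆ →
              ∀ s : ℤ, s = 1 ∨ s = -1 →
                ¬ (W.c₆ / 3 ^ n₆ - 2 * s = 0 ∨ (2 : ℤ) ≤ padicValRat 3 (W.c₆ / 3 ^ n₆ - 2 * s)))) →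
          MissingUpperBoundAt W 3) ∧
      (∀ (W : WeierstrassCurve ℚ) [W.IsElliptic] [W.IsGloballyMinimal] (p : ℕ) [Fact p.Prime],
          W.analyticRank = 0 → ClassX4 W p → Surj W p → 0 ≤ padicValRat p W.j →
          ¬ (TypeGOrd W p ∧ semistabilityIndex W p = 2) →
          padicValNat p ((W.baseChange ℚ_[p]).localTamagawaNumber ℤ_[p]) + 2 ≤
            padicValNat p W.tamagawaProduct →
          MissingUpperBoundAt W p) ∧
      (∀ (W : WeierstrassCurve ℚ) [W.IsElliptic] [W.IsGloballyMinimal] (p : ℕ) [Fact p.Prime],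
          W.analyticRank = 0 → ClassX4 W p → Surj W p → 0 ≤ padicValRat p W.j →
          ¬ (TypeGOrd W p ∧ semistabilityIndex W p = 2) →
          (∃ q : ℚ, shaAn W = (q : ℂ) ∧ Odd (padicValRat p q)) → MissingUpperBoundAt W p) ∧
      (∀ (W : WeierstrassCurve ℚ) [W.IsElliptic] [W.IsGloballyMinimal] (p : ℕ) [Fact p.Prime],
          W.analyticRank = 0 → ClassX4 W p → Surj W p → 0 ≤ padicValRat p W.j →
          ¬ (TypeGOrd W p ∧ semistabilityIndex W p = 2) →
          (∀ (N : ℕ) [NeZero N] (D : ModularParametrizationData W N), (p : ℤ) ∣ D.maninConstant) →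
          MissingUpperBoundAt W p) := by
  rw [x4SharpUnitFree_iff_lower_and_residues_sharp_exoticTypeG_noL20 hCT hKatoS hDel hGZK hmod hmodD
    hKatoχ hK, exotic_iff_exotic_of_core]


end Summit.BirchSwinnertonDyer.Rank1Residual.Additive

end
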